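import Summits.CriticalPhenomena.PercolationContinuityZ3.Theorems.PercNearOneGluingNoHeavyLowerTailSahiThreeCopyCylinder

/-!
# `NoHeavyLowerTail` (crux stmt-CriticalPhenomena-4575), Sahi programme: **THE SLICES OF THE THREE-COPY SAHI COEFFICIENT** —
# `c_{(k,b)}(f,g,h)` along a coordinate as three coefficients of mixed sections plus explicit difference terms (the census's
# "mixed-section functionals Ψ", CENSUS §175 README-W197, now exact identities)

Support file (Sahi cell, seat `prim-sahi-p1`, generation 53; `--supports stmt-CriticalPhenomena-4575`); companion of `…SahiThreeCopy`.
Pure proofs, no definitions; no `sorry`, standard axioms.  With the sections `f⁰ ≤ f¹` (`sec f false/true`) and `δf = f¹ − f⁰` etc.: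

* `tc_cons_zero` / `tc_cons_three`: `c_{(0,b)}(f,g,h) = c_b(f⁰,g⁰,h⁰)`, `c_{(3,b)}(f,g,h) = c_b(f¹,g¹,h¹)` (frozen coordinates pass to sections).
* ★ `tc_cons_one`: `c_{(1,b)}(f,g,h) = c_b(f¹,g⁰,h⁰) + c_b(f⁰,g¹,h⁰) + c_b(f⁰,g⁰,h¹)
     + Σ_{cyc} [2N_b(x⁰·δy·δz;1;1) − N_b(x⁰; δy·δz; 1)] + 2N_b(δf·δg·δh;1;1)`.
* ★ `tc_cons_two`: `c_{(2,b)}(f,g,h) = c_b(f⁰,g¹,h¹) + c_b(f¹,g⁰,h¹) + c_b(f¹,g¹,h⁰)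
     + Σ_{cyc} [2N_b(x⁰·δy·δz;1;1) − N_b(x⁰; δy·δz; 1)] − Σ_{cyc} N_b(δx; δy·δz; 1) + 4N_b(δf·δg·δh;1;1)`.

So an induction on the dimension for 3C-SAHI (`ThreeCopySahi`) would have to control the bracketed "Harris gaps with the non-monotone
partner `δy·δz`"; the formal LPs of this generation (memo FROM-prim-sahi-p1-gen53 §0) show this cannot be done from 3C one level down,
three-copy Harris and positivity alone.  These identities are the exact bookkeeping for any future attempt (and a second transcription check
of the census's slice remark). [this work; CENSUS §175 W197]
-/

namespace Summit.CriticalPhenomena.PercolationContinuityZ3.Theorems.SahiThreeCopy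

open Finset Function Literature.Combinatorics.Sahi2008
open scoped BigOperators

noncomputable section

variable {d : ℕ}

/-! ### §1 Expansion lemmas for products of differences inside `N_b` -/

/-- `N_b((f₁−f₀)·u·(h₁−h₀);1;1)` expanded. [this work] -/
theorem N3_sub_mul_mid_mul_sub (b : Fin d → ℕ) (f₁ f₀ u h₁ h₀ : Pt d → ℝ) :
    N3 b ((f₁ - f₀) * u * (h₁ - h₀)) 1 1 =
      N3 b (f₁ * u * h₁) 1 1 - N3 b (f₁ * u * h₀) 1 1 - N3 b (f₀ * u * h₁) 1 1 + N3 b (f₀ * u * h₀) 1 1 := by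
  have : (f₁ - f₀) * u * (h₁ - h₀) = f₁ * u * h₁ - f₁ * u * h₀ - (f₀ * u * h₁ - f₀ * u * h₀) := by ring
  rw [this, N3_sub_left, N3_sub_left, N3_sub_left]
  ring

/-- `N_b((f₁−f₀)·(g₁−g₀)·u;1;1)` expanded. [this work] -/
theorem N3_sub_mul_sub_mul_right (b : Fin d → ℕ) (f₁ f₀ g₁ g₀ u : Pt d → ℝ) :
    N3 b ((f₁ - f₀) * (g₁ - g₀) * u) 1 1 =
      N3 b (f₁ * g₁ * u) 1 1 - N3 b (f₁ * g₀ * u) 1 1 - N3 b (f₀ * g₁ * u) 1 1 + N3 b (f₀ * g₀ * u) 1 1 := by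
  have : (f₁ - f₀) * (g₁ - g₀) * u = f₁ * g₁ * u - f₁ * g₀ * u - (f₀ * g₁ * u - f₀ * g₀ * u) := by ring
  rw [this, N3_sub_left, N3_sub_left, N3_sub_left]
  ring

/-- `N_b(u; (p₁−p₀)·(r₁−r₀); 1)` expanded (second slot). [this work] -/
theorem N3_mid_sub_mul_sub (b : Fin d → ℕ) (u p₁ p₀ r₁ r₀ : Pt d → ℝ) :
    N3 b u ((p₁ - p₀) * (r₁ - r₀)) 1 =
      N3 b u (p₁ * r₁) 1 - N3 b u (p₁ * r₀) 1 - N3 b u (p₀ * r₁) 1 + N3 b u (p₀ * r₀) 1 := by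
  have : (p₁ - p₀) * (r₁ - r₀) = p₁ * r₁ - p₁ * r₀ - (p₀ * r₁ - p₀ * r₀) := by ring
  rw [this, N3_sub_mid, N3_sub_mid, N3_sub_mid]
  ring

/-- `N_b(δf·δg·δh;1;1)` expanded (eight terms). [this work] -/
theorem N3_sub_mul_sub_mul_sub (b : Fin d → ℕ) (f₁ f₀ g₁ g₀ h₁ h₀ : Pt d → ℝ) :
    N3 b ((f₁ - f₀) * (g₁ - g₀) * (h₁ - h₀)) 1 1 =
      N3 b (f₁ * g₁ * h₁) 1 1 - N3 b (f₁ * g₁ * h₀) 1 1 - N3 b (f₁ * g₀ * h₁) 1 1 + N3 b (f₁ * g₀ * h₀) 1 1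
      - N3 b (f₀ * g₁ * h₁) 1 1 + N3 b (f₀ * g₁ * h₀) 1 1 + N3 b (f₀ * g₀ * h₁) 1 1 - N3 b (f₀ * g₀ * h₀) 1 1 := by
  have : (f₁ - f₀) * (g₁ - g₀) * (h₁ - h₀) = f₁ * (g₁ - g₀) * (h₁ - h₀) - f₀ * (g₁ - g₀) * (h₁ - h₀) := by ring
  rw [this, N3_sub_left, N3_mul_sub_mul_sub, N3_mul_sub_mul_sub]
  ring

/-- `N_b(δf; δg·δh; 1)` expanded (eight terms). [this work] -/
theorem N3_sub_mid_sub_mul_sub (b : Fin d → ℕ) (f₁ f₀ g₁ g₀ h₁ h₀ : Pt d → ℝ) :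
    N3 b (f₁ - f₀) ((g₁ - g₀) * (h₁ - h₀)) 1 =
      N3 b f₁ (g₁ * h₁) 1 - N3 b f₁ (g₁ * h₀) 1 - N3 b f₁ (g₀ * h₁) 1 + N3 b f₁ (g₀ * h₀) 1
      - N3 b f₀ (g₁ * h₁) 1 + N3 b f₀ (g₁ * h₀) 1 + N3 b f₀ (g₀ * h₁) 1 - N3 b f₀ (g₀ * h₀) 1 := by
  rw [N3_sub_left, N3_mid_sub_mul_sub, N3_mid_sub_mul_sub]
  ring

/-! ### §2 The frozen slices -/

/-- `c_{(0,b)}(f,g,h) = c_b(f⁰,g⁰,h⁰)`. [this work] -/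
theorem tc_cons_zero (b : Fin d → ℕ) (f g h : Pt (d + 1) → ℝ) :
    tc (Fin.cons 0 b : Fin (d + 1) → ℕ) f g h = tc b (sec f false) (sec g false) (sec h false) := by
  unfold tc
  rw [N3_cons_zero, N3_cons_zero, N3_cons_zero, N3_cons_zero, N3_cons_zero]
  simp only [sec_mul, sec_one]

/-- `c_{(3,b)}(f,g,h) = c_b(f¹,g¹,h¹)`. [this work] -/
theorem tc_cons_three (b : Fin d → ℕ) (f g h : Pt (d + 1) → ℝ) :
    tc (Fin.cons 3 b : Fin (d + 1) → ℕ) f g h = tc b (sec f true) (sec g true) (sec h true) := by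
  unfold tc
  rw [N3_cons_three, N3_cons_three, N3_cons_three, N3_cons_three, N3_cons_three]
  simp only [sec_mul, sec_one]

/-- Empty slices: `c_{(k+4,b)} = 0`. [this work] -/
theorem tc_cons_add_four (k : ℕ) (b : Fin d → ℕ) (f g h : Pt (d + 1) → ℝ) :
    tc (Fin.cons (k + 4) b : Fin (d + 1) → ℕ) f g h = 0 := by
  unfold tc
  rw [N3_cons_add_four, N3_cons_add_four, N3_cons_add_four, N3_cons_add_four, N3_cons_add_four]
  ring

/-! ### §3 The two mixed slices -/

/-- ★ **Type-1 slice of the three-copy Sahi coefficient** (one copy sees the top sections):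
`c_{(1,b)}(f,g,h) = c_b(f¹,g⁰,h⁰) + c_b(f⁰,g¹,h⁰) + c_b(f⁰,g⁰,h¹) + Σ_cyc [2N_b(x⁰δyδz;1;1) − N_b(x⁰;δyδz;1)] + 2N_b(δfδgδh;1;1)`.
[this work; CENSUS §175 W197 (slice remark)] -/
theorem tc_cons_one (b : Fin d → ℕ) (f g h : Pt (d + 1) → ℝ) :
    tc (Fin.cons 1 b : Fin (d + 1) → ℕ) f g h =
      tc b (sec f true) (sec g false) (sec h false) + tc b (sec f false) (sec g true) (sec h false) +
        tc b (sec f false) (sec g false) (sec h true)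
      + (2 * N3 b (sec f false * (sec g true - sec g false) * (sec h true - sec h false)) 1 1
          - N3 b (sec f false) ((sec g true - sec g false) * (sec h true - sec h false)) 1)
      + (2 * N3 b ((sec f true - sec f false) * sec g false * (sec h true - sec h false)) 1 1
          - N3 b (sec g false) ((sec f true - sec f false) * (sec h true - sec h false)) 1)
      + (2 * N3 b ((sec f true - sec f false) * (sec g true - sec g false) * sec h false) 1 1
          - N3 b (sec h false) ((sec f true - sec f false) * (sec g true - sec g false)) 1)
      + 2 * N3 b ((sec f true - sec f false) * (sec g true - sec g false) * (sec h true - sec h false)) 1 1 := by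
  unfold tc
  rw [N3_cons_one, N3_cons_one, N3_cons_one, N3_cons_one, N3_cons_one]
  simp only [sec_mul, sec_one]
  rw [N3_mul_sub_mul_sub b (sec f false) (sec g true) (sec g false) (sec h true) (sec h false),
    N3_mid_sub_mul_sub b (sec f false) (sec g true) (sec g false) (sec h true) (sec h false),
    N3_sub_mul_mid_mul_sub b (sec f true) (sec f false) (sec g false) (sec h true) (sec h false),
    N3_mid_sub_mul_sub b (sec g false) (sec f true) (sec f false) (sec h true) (sec h false),
    N3_sub_mul_sub_mul_right b (sec f true) (sec f false) (sec g true) (sec g false) (sec h false),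
    N3_mid_sub_mul_sub b (sec h false) (sec f true) (sec f false) (sec g true) (sec g false),
    N3_sub_mul_sub_mul_sub b (sec f true) (sec f false) (sec g true) (sec g false) (sec h true) (sec h false)]
  ring

/-- ★ **Type-2 slice of the three-copy Sahi coefficient** (one copy sees the bottom sections):
`c_{(2,b)}(f,g,h) = c_b(f⁰,g¹,h¹) + c_b(f¹,g⁰,h¹) + c_b(f¹,g¹,h⁰) + Σ_cyc [2N_b(x⁰δyδz;1;1) − N_b(x⁰;δyδz;1)] − Σ_cyc N_b(δx;δyδz;1)
 + 4N_b(δfδgδh;1;1)`. [this work; CENSUS §175 W197 (slice remark)] -/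
theorem tc_cons_two (b : Fin d → ℕ) (f g h : Pt (d + 1) → ℝ) :
    tc (Fin.cons 2 b : Fin (d + 1) → ℕ) f g h =
      tc b (sec f false) (sec g true) (sec h true) + tc b (sec f true) (sec g false) (sec h true) +
        tc b (sec f true) (sec g true) (sec h false)
      + (2 * N3 b (sec f false * (sec g true - sec g false) * (sec h true - sec h false)) 1 1
          - N3 b (sec f false) ((sec g true - sec g false) * (sec h true - sec h false)) 1)
      + (2 * N3 b ((sec f true - sec f false) * sec g false * (sec h true - sec h false)) 1 1
          - N3 b (sec g false) ((sec f true - sec f false) * (sec h true - sec h false)) 1)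
      + (2 * N3 b ((sec f true - sec f false) * (sec g true - sec g false) * sec h false) 1 1
          - N3 b (sec h false) ((sec f true - sec f false) * (sec g true - sec g false)) 1)
      - (N3 b (sec f true - sec f false) ((sec g true - sec g false) * (sec h true - sec h false)) 1
          + N3 b (sec g true - sec g false) ((sec f true - sec f false) * (sec h true - sec h false)) 1
          + N3 b (sec h true - sec h false) ((sec f true - sec f false) * (sec g true - sec g false)) 1)
      + 4 * N3 b ((sec f true - sec f false) * (sec g true - sec g false) * (sec h true - sec h false)) 1 1 := by
  unfold tc
  rw [N3_cons_two, N3_cons_two, N3_cons_two, N3_cons_two, N3_cons_two]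
  simp only [sec_mul, sec_one]
  rw [N3_mul_sub_mul_sub b (sec f false) (sec g true) (sec g false) (sec h true) (sec h false),
    N3_mid_sub_mul_sub b (sec f false) (sec g true) (sec g false) (sec h true) (sec h false),
    N3_sub_mul_mid_mul_sub b (sec f true) (sec f false) (sec g false) (sec h true) (sec h false),
    N3_mid_sub_mul_sub b (sec g false) (sec f true) (sec f false) (sec h true) (sec h false),
    N3_sub_mul_sub_mul_right b (sec f true) (sec f false) (sec g true) (sec g false) (sec h false),
    N3_mid_sub_mul_sub b (sec h false) (sec f true) (sec f false) (sec g true) (sec g false),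
    N3_sub_mid_sub_mul_sub b (sec f true) (sec f false) (sec g true) (sec g false) (sec h true) (sec h false),
    N3_sub_mid_sub_mul_sub b (sec g true) (sec g false) (sec f true) (sec f false) (sec h true) (sec h false),
    N3_sub_mid_sub_mul_sub b (sec h true) (sec h false) (sec f true) (sec f false) (sec g true) (sec g false),
    N3_sub_mul_sub_mul_sub b (sec f true) (sec f false) (sec g true) (sec g false) (sec h true) (sec h false)]
  ring

end

end Summit.CriticalPhenomena.PercolationContinuityZ3.Theorems.SahiThreeCopy
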